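import Literature.Probability.RandomPlanarGeometry.SAWAdsorptionFreeEnergyFunction
import Literature.Probability.RandomPlanarGeometry.BDGS2012CountBoundsProofs
import Mathlib.Algebra.Order.Chebyshev
import HarnessLib

/-!
# The adsorbed bridge rate dominates `μ`: `β(a) ≥ μ(ℤ²)` for `a ≥ 1`, hence `e^{κ(a)} = β(a)`

Topic `Literature/Probability/RandomPlanarGeometry` (continues `SAWAdsorptionFreeEnergyFunction.lean`: `e^{κ(a)} = max(β(a), μ)`
for `a ≥ 1`, `β(a)` the growth rate of the wall-returning `x`-bridges `AdsIrr.Bw n a`; `SAWAdsorptionArchUnfolding.lean`: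
arches `Zd.arches k`, `a·A_k(a) ≤ e^{6√k} B_{k+1}(a)`; `SAWUnfoldingTwoSided.lean`: rectangle walks `Zd.rectangleFuns n` and
`b_n ≤ e^{6√n} #rectangleFuns n`; `HammersleyWelshBound.lean`: `e^{-(c₁+8)√n} μⁿ ≤ b_n`).

Two rectangle walks of `ℤ²` of the same height span `H`, the second reflected in height and placed to the right of the first
(one unit step between them), form an ARCH of length `2n+1` (heights in `[0, H]`, both ends on the wall); the map is injective,
so by Cauchy–Schwarz over `H ∈ [0, n]`, `#arches(2n+1) ≥ #rectangleFuns(n)² / (n+1) ≥ e^{-O(√n)} μ^{2n}`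
(`Zd.card_rectangleFuns_sq_le`, `Zd.exp_mul_pow_le_archZ_one`). With the arch bound of `SAWAdsorptionArchUnfolding.lean`,
`B_{2n+2}(1) ≥ e^{-O(√n)} μ^{2n}`, whence **`μ ≤ β(1) ≤ β(a)`** (`Zd.connectiveConstant_le_bridgeRate`) and
**`e^{κ(a)} = β(a)` for every `a ≥ 1`** (`Zd.adsRate_eq_bridgeRate`): the adsorption free energy IS the growth rate of the
wall-returning `x`-bridges, so certificates on their irreducible pieces (`SAWAdsorptionUpperBound209.lean` &c.) bound `κ` itself.

Printed counterpart (lit-2 g15): the lane's wall-returning `x`-bridges are exactly the «loops unfolded in the x-direction»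
of Hammersley–Torrie–Whittington 1982 / Janse van Rensburg–Whittington 2013 (`B_n(a) = L‡_n(a)`), and Janse van
Rensburg–Whittington 2013, Lemma 1 (arXiv p. 3; proof attributed to HTW82) prints «for unfolding in the x-direction and
`a > 0` the following limits exist and are equal: `lim n⁻¹ log C_n(a) = lim n⁻¹ log L_n(a) = lim n⁻¹ log C‡_n(a) =
lim n⁻¹ log L‡_n(a) ≡ κ(a)`. Also, `κ(a) = log μ_d` for `a ≤ 1`.» — printed for all `a > 0` in every `d ≥ 2` as an equality of
four limits; formalised here for `d = 2`, `a ≥ 1`, as `adsRate a = β` under the hypothesis that `β = lim B_n(a)^{1/n}`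
(which `AdsIrr.exists_tendsto_Bw_rpow` supplies). Label: CONSOLIDATION (new kernel proof: rectangle walks + Cauchy–Schwarz).
Pure standard axioms.
-/

noncomputable section

open Finset Filter Topology Literature.Probability.LatticeModels SimpleGraph
open scoped BigOperators

namespace Literature.Probability.RandomPlanarGeometry.SAW.Zd

/-! ### Two rectangle walks make an arch -/

/-- The reflected-and-shifted copy of a point: height `H - x₀`, wall coordinate `W + 1 + x₁`. [folklore] -/
def reflShift (H W : ℤ) (x : Site 2) : Site 2 := ![H - x 0, W + 1 + x 1]

/-- Coordinates of `reflShift`. [folklore] -/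
@[simp] private theorem reflShift_apply_zero (H W : ℤ) (x : Site 2) : reflShift H W x 0 = H - x 0 := rfl

/-- Coordinates of `reflShift`. [folklore] -/
@[simp] private theorem reflShift_apply_one (H W : ℤ) (x : Site 2) : reflShift H W x 1 = W + 1 + x 1 := rfl

/-- A point of `ℤ²` is determined by its two coordinates. [folklore] -/
private theorem site_ext' {x y : Site 2} (h0 : x 0 = y 0) (h1 : x 1 = y 1) : x = y := by
  funext j; fin_cases j <;> assumption

/-- `reflShift` is injective. [folklore] -/
private theorem reflShift_injective (H W : ℤ) : Function.Injective (reflShift H W) := by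
  intro x y h
  have h0 := congrFun h 0
  have h1 := congrFun h 1
  simp only [reflShift_apply_zero, reflShift_apply_one] at h0 h1
  exact site_ext' (by omega) (by omega)

/-- `reflShift` (a reflection composed with a translation) preserves adjacency. [folklore] -/
private theorem adj_reflShift {H W : ℤ} {x y : Site 2} (h : (zdGraph 2).Adj x y) :
    (zdGraph 2).Adj (reflShift H W x) (reflShift H W y) := by
  rw [zdGraph_adj_iff_sub] at h ⊢
  obtain ⟨i, hi | hi⟩ := h
  · have h0 := congrFun hi 0
    have h1 := congrFun hi 1
    simp only [Pi.sub_apply] at h0 h1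
    fin_cases i
    · refine ⟨0, Or.inr ?_⟩
      funext j; fin_cases j <;> simp [reflShift] <;> simp at h0 h1 <;> omega
    · refine ⟨1, Or.inl ?_⟩
      funext j; fin_cases j <;> simp [reflShift] <;> simp at h0 h1 <;> omega
  · have h0 := congrFun hi 0
    have h1 := congrFun hi 1
    simp only [Pi.sub_apply] at h0 h1
    fin_cases i
    · refine ⟨0, Or.inl ?_⟩
      funext j; fin_cases j <;> simp [reflShift] <;> simp at h0 h1 <;> omega
    · refine ⟨1, Or.inr ?_⟩
      funext j; fin_cases j <;> simp [reflShift] <;> simp at h0 h1 <;> omega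

/-- **Gluing two rectangle walks into an arch**: the first `n` steps are `R`, then one step along the wall direction, then
the height-reflected copy of `R'` shifted to the right of `R`. [cite: HammersleyTorrieWhittington1982, existence of the free energy κ; reported in BeatonGuttmannJensen2012Adsorption §1 p. 1 (arXiv:1110.6695v1)] -/
def archOfRect (n : ℕ) (R R' : ℕ → Site 2) : ℕ → Site 2 := fun i =>
  if i ≤ n then R i else reflShift (R n 0) (R n 1) (R' (i - (n + 1)))

section Glue

variable {n : ℕ} {R R' : ℕ → Site 2}

/-- Values on the first half. [folklore] -/
private theorem archOfRect_of_le {i : ℕ} (hi : i ≤ n) : archOfRect n R R' i = R i := if_pos hi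

/-- Values on the second half. [folklore] -/
private theorem archOfRect_of_lt {i : ℕ} (hi : n < i) :
    archOfRect n R R' i = reflShift (R n 0) (R n 1) (R' (i - (n + 1))) := if_neg (not_le.2 hi)

/-- **The glued walk is an arch of length `2n+1`** when `R, R'` are rectangle walks with the same height span.
[cite: HammersleyTorrieWhittington1982, existence of the free energy κ; reported in BeatonGuttmannJensen2012Adsorption §1 p. 1 (arXiv:1110.6695v1)] -/
theorem archOfRect_mem_arches (hR : R ∈ rectangleFuns n) (hR' : R' ∈ rectangleFuns n) (hH : R n 0 = R' n 0) :
    archOfRect n R R' ∈ arches (2 * n + 1) := by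
  obtain ⟨hRs, hRb⟩ := mem_rectangleFuns.1 hR
  obtain ⟨hRs', hRb'⟩ := mem_rectangleFuns.1 hR'
  obtain ⟨h0, hend, hadj, hinj⟩ := mem_saws.1 hRs
  obtain ⟨h0', hend', hadj', hinj'⟩ := mem_saws.1 hRs'
  have hsaws : archOfRect n R R' ∈ saws 2 (2 * n + 1) := by
    refine mem_saws.2 ⟨by rw [archOfRect_of_le (Nat.zero_le n), h0], fun i hi => ?_, fun i hi => ?_, ?_⟩
    · rw [archOfRect_of_lt (by omega), archOfRect_of_lt (by omega), hend' (i - (n + 1)) (by omega),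
        show 2 * n + 1 - (n + 1) = n by omega]
    · rcases Nat.lt_or_ge i n with hin | hin
      · rw [archOfRect_of_le hin.le, archOfRect_of_le (by omega)]; exact hadj i hin
      · rcases hin.eq_or_lt with rfl | hlt
        · -- the junction: one step along the wall direction
          rw [archOfRect_of_le le_rfl, archOfRect_of_lt (Nat.lt_succ_self _), Nat.sub_self, h0']
          rw [zdGraph_adj_iff_sub]
          refine ⟨1, Or.inl ?_⟩
          funext j; fin_cases j <;> simp [reflShift]
        · rw [archOfRect_of_lt hlt, archOfRect_of_lt (by omega), show i + 1 - (n + 1) = i - (n + 1) + 1 by omega]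
          exact adj_reflShift (hadj' _ (by omega))
    · intro i hi j hj hij
      simp only [Set.mem_setOf_eq] at hi hj
      rcases le_or_gt i n with hin | hin <;> rcases le_or_gt j n with hjn | hjn
      · rw [archOfRect_of_le hin, archOfRect_of_le hjn] at hij
        exact hinj (show i ∈ {i | i ≤ n} from hin) (show j ∈ {i | i ≤ n} from hjn) hij
      · exfalso
        rw [archOfRect_of_le hin, archOfRect_of_lt hjn] at hij
        have h1 := congrFun hij 1
        simp only [reflShift_apply_one] at h1
        have := (hRb i hin 1).2
        have := (hRb' (j - (n + 1)) (by omega) 1).1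
        omega
      · exfalso
        rw [archOfRect_of_lt hin, archOfRect_of_le hjn] at hij
        have h1 := congrFun hij 1
        simp only [reflShift_apply_one] at h1
        have := (hRb j hjn 1).2
        have := (hRb' (i - (n + 1)) (by omega) 1).1
        omega
      · rw [archOfRect_of_lt hin, archOfRect_of_lt hjn] at hij
        have := hinj' (show i - (n + 1) ∈ {i | i ≤ n} by simp; omega) (show j - (n + 1) ∈ {i | i ≤ n} by simp; omega)
          (reflShift_injective _ _ hij)
        omega
  refine mem_arches.2 ⟨mem_hpWalks.2 ⟨hsaws, fun i hi => ?_⟩, ?_⟩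
  · rcases le_or_gt i n with hin | hin
    · rw [archOfRect_of_le hin]; exact (hRb i hin 0).1
    · rw [archOfRect_of_lt hin, reflShift_apply_zero, hH]
      have := (hRb' (i - (n + 1)) (by omega) 0).2
      omega
  · rw [archOfRect_of_lt (by omega), reflShift_apply_zero, show 2 * n + 1 - (n + 1) = n by omega, hH, sub_self]

/-- **The gluing is injective** on pairs of rectangle walks. [cite: MadrasSlade1993, §1.2 (p. 11)] -/
theorem archOfRect_inj {S S' : ℕ → Site 2} (hR : R ∈ rectangleFuns n) (hR' : R' ∈ rectangleFuns n)
    (hS : S ∈ rectangleFuns n) (hS' : S' ∈ rectangleFuns n) (h : archOfRect n R R' = archOfRect n S S') :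
    R = S ∧ R' = S' := by
  obtain ⟨-, hend, -, -⟩ := mem_saws.1 (mem_rectangleFuns.1 hR).1
  obtain ⟨-, hendS, -, -⟩ := mem_saws.1 (mem_rectangleFuns.1 hS).1
  obtain ⟨-, hend', -, -⟩ := mem_saws.1 (mem_rectangleFuns.1 hR').1
  obtain ⟨-, hendS', -, -⟩ := mem_saws.1 (mem_rectangleFuns.1 hS').1
  have hRS : R = S := by
    funext i
    rcases le_or_gt i n with hi | hi
    · have := congrFun h i; rwa [archOfRect_of_le hi, archOfRect_of_le hi] at this
    · have := congrFun h n; rw [archOfRect_of_le le_rfl, archOfRect_of_le le_rfl] at this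
      rw [hend i hi.le, hendS i hi.le, this]
  refine ⟨hRS, ?_⟩
  funext j
  rcases le_or_gt j n with hj | hj
  · have := congrFun h (j + (n + 1))
    rw [archOfRect_of_lt (by omega), archOfRect_of_lt (by omega), Nat.add_sub_cancel, hRS] at this
    exact reflShift_injective _ _ this
  · have := congrFun h (n + (n + 1))
    rw [archOfRect_of_lt (by omega), archOfRect_of_lt (by omega), Nat.add_sub_cancel, hRS] at this
    rw [hend' j hj.le, hendS' j hj.le]
    exact reflShift_injective _ _ this

end Glue

/-! ### Counting: `#rectangleFuns(n)² ≤ (n+1) · #arches(2n+1)` -/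

/-- The height span of an `n`-step rectangle walk lies in `[0, n]`. [cite: MadrasSlade1993, §1.2 (p. 11)] -/
theorem rect_height_mem_range {n : ℕ} {R : ℕ → Site 2} (hR : R ∈ rectangleFuns n) :
    R n 0 ∈ (Finset.range (n + 1)).image (fun k : ℕ => (k : ℤ)) := by
  obtain ⟨hRs, hRb⟩ := mem_rectangleFuns.1 hR
  obtain ⟨h0, -, hadj, -⟩ := mem_saws.1 hRs
  have hle := abs_apply_le_of_adj h0 hadj n le_rfl 0
  have hnn := (hRb 0 (Nat.zero_le n) 0).2
  rw [h0] at hnn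
  simp only [Pi.zero_apply] at hnn
  rw [abs_le] at hle
  refine Finset.mem_image.2 ⟨(R n 0).toNat, Finset.mem_range.2 ?_, ?_⟩
  · have : (R n 0).toNat ≤ n := by rw [Int.toNat_le]; exact hle.2
    omega
  · exact Int.toNat_of_nonneg hnn

/-- **`#rectangleFuns(n)² ≤ (n+1) · #arches(2n+1)`**: pairs of rectangle walks with equal height span inject into arches
(`Zd.archOfRect_mem_arches`, `Zd.archOfRect_inj`), and Cauchy–Schwarz over the `n+1` possible spans.
[cite: HammersleyTorrieWhittington1982, existence of the free energy κ; reported in BeatonGuttmannJensen2012Adsorption §1 p. 1 (arXiv:1110.6695v1)] -/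
theorem card_rectangleFuns_sq_le (n : ℕ) :
    ((rectangleFuns n).card : ℝ) ^ 2 ≤ ((n : ℝ) + 1) * (arches (2 * n + 1)).card := by
  classical
  set S := (Finset.range (n + 1)).image (fun k : ℕ => (k : ℤ)) with hS
  set fib : ℤ → Finset (ℕ → Site 2) := fun H => (rectangleFuns n).filter (fun R => R n 0 = H) with hfib
  -- `#Rect = Σ_H #fib H`
  have hsum : (rectangleFuns n).card = ∑ H ∈ S, (fib H).card :=
    Finset.card_eq_sum_card_fiberwise fun R hR => rect_height_mem_range hR
  -- pairs with equal span inject into arches: `Σ_H (#fib H)² ≤ #arches(2n+1)`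
  have hpairs : ∑ H ∈ S, (fib H).card ^ 2 ≤ (arches (2 * n + 1)).card := by
    have hdisj : ∑ H ∈ S, (fib H).card ^ 2 = (S.biUnion fun H => fib H ×ˢ fib H).card := by
      rw [Finset.card_biUnion]
      · exact Finset.sum_congr rfl fun H _ => by rw [Finset.card_product, sq]
      · intro H _ H' _ hne
        refine Finset.disjoint_left.2 fun p hp hp' => hne ?_
        rw [Finset.mem_product] at hp hp'
        exact ((Finset.mem_filter.1 hp.1).2).symm.trans (Finset.mem_filter.1 hp'.1).2
    rw [hdisj]
    refine Finset.card_le_card_of_injOn (fun p => archOfRect n p.1 p.2) (fun p hp => ?_) (fun p hp q hq hpq => ?_)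
    · rw [Finset.mem_coe, Finset.mem_biUnion] at hp
      obtain ⟨H, -, hp⟩ := hp
      rw [Finset.mem_product] at hp
      obtain ⟨h1, h2⟩ := hp
      obtain ⟨hR, hRH⟩ := Finset.mem_filter.1 h1
      obtain ⟨hR', hRH'⟩ := Finset.mem_filter.1 h2
      exact archOfRect_mem_arches hR hR' (hRH.trans hRH'.symm)
    · rw [Finset.mem_coe, Finset.mem_biUnion] at hp hq
      obtain ⟨_, -, hp⟩ := hp
      obtain ⟨_, -, hq⟩ := hq
      rw [Finset.mem_product] at hp hq
      obtain ⟨e1, e2⟩ := archOfRect_inj (Finset.mem_filter.1 hp.1).1 (Finset.mem_filter.1 hp.2).1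
        (Finset.mem_filter.1 hq.1).1 (Finset.mem_filter.1 hq.2).1 hpq
      exact Prod.ext e1 e2
  -- Cauchy–Schwarz
  have hCS := sq_sum_le_card_mul_sum_sq (s := S) (f := fun H => ((fib H).card : ℝ))
  have hScard : (S.card : ℝ) ≤ (n : ℝ) + 1 := by
    have : S.card ≤ n + 1 := (Finset.card_image_le).trans (by rw [Finset.card_range])
    exact_mod_cast this
  have hsumR : ((rectangleFuns n).card : ℝ) = ∑ H ∈ S, ((fib H).card : ℝ) := by rw [hsum]; push_cast; rfl
  have hpairsR : ∑ H ∈ S, ((fib H).card : ℝ) ^ 2 ≤ (arches (2 * n + 1)).card := by exact_mod_cast hpairs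
  rw [hsumR]
  calc (∑ H ∈ S, ((fib H).card : ℝ)) ^ 2 ≤ S.card * ∑ H ∈ S, ((fib H).card : ℝ) ^ 2 := hCS
    _ ≤ ((n : ℝ) + 1) * (arches (2 * n + 1)).card :=
        mul_le_mul hScard hpairsR (Finset.sum_nonneg fun _ _ => sq_nonneg _) (by positivity)

/-- `A_k(1) = #arches(k)`. [cite: MadrasSlade1993, §1.2 (p. 11)] -/
theorem archZ_one (k : ℕ) : archZ k 1 = (arches k).card := by
  simp [archZ]

/-- **`#arches(2n+1) ≥ e^{-36√n} μ^{2n} / (n+1)`**: from `#rectangleFuns n ≥ e^{-6√n} b_n ≥ e^{-6√n} e^{-12√n} μⁿ`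
(`c₁ + 8 = 12` on `ℤ²`). [cite: MadrasSlade1993, Corollary 3.1.6, eq. (3.1.10) (p. 61)] -/
theorem exp_mul_pow_le_card_arches (n : ℕ) :
    Real.exp (-(36 * Real.sqrt n)) * connectiveConstant 2 ^ (2 * n) ≤ ((n : ℝ) + 1) * (arches (2 * n + 1)).card := by
  have hμ : 0 < connectiveConstant 2 := connectiveConstant_pos 2
  -- `e^{-12√n} μ^n ≤ b_n ≤ e^{6√n} #Rect`
  have hb0 := exp_mul_pow_le_bridgeCount_explicit (d := 2) n
  have hc1 : (count 2 1 : ℝ) + 8 ≤ 12 := by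
    have := count_one_le 2
    have : (count 2 1 : ℝ) ≤ 4 := by exact_mod_cast this
    linarith
  have hb : Real.exp (-(12 * Real.sqrt n)) * connectiveConstant 2 ^ n ≤ bridgeCount 2 n := by
    refine le_trans (mul_le_mul_of_nonneg_right (Real.exp_le_exp.2 ?_) (pow_nonneg hμ.le _)) hb0
    have := Real.sqrt_nonneg (n : ℝ)
    nlinarith
  have hr := card_bridges_le_exp_mul_card_rectangleFuns n
  have hR : Real.exp (-(18 * Real.sqrt n)) * connectiveConstant 2 ^ n ≤ (rectangleFuns n).card := by
    have h1 : Real.exp (-(12 * Real.sqrt n)) * connectiveConstant 2 ^ n ≤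
        Real.exp (6 * Real.sqrt n) * (rectangleFuns n).card := hb.trans hr
    have hE : Real.exp (-(18 * Real.sqrt n)) = Real.exp (-(6 * Real.sqrt n)) * Real.exp (-(12 * Real.sqrt n)) := by
      rw [← Real.exp_add]; ring_nf
    rw [hE, mul_assoc]
    calc Real.exp (-(6 * Real.sqrt n)) * (Real.exp (-(12 * Real.sqrt n)) * connectiveConstant 2 ^ n)
        ≤ Real.exp (-(6 * Real.sqrt n)) * (Real.exp (6 * Real.sqrt n) * (rectangleFuns n).card) :=
          mul_le_mul_of_nonneg_left h1 (Real.exp_nonneg _)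
      _ = (rectangleFuns n).card := by rw [← mul_assoc, ← Real.exp_add]; simp
  have hR0 : 0 ≤ Real.exp (-(18 * Real.sqrt n)) * connectiveConstant 2 ^ n := by positivity
  calc Real.exp (-(36 * Real.sqrt n)) * connectiveConstant 2 ^ (2 * n)
      = (Real.exp (-(18 * Real.sqrt n)) * connectiveConstant 2 ^ n) ^ 2 := by
        rw [mul_pow, ← Real.exp_nat_mul, ← pow_mul]; ring_nf
    _ ≤ ((rectangleFuns n).card : ℝ) ^ 2 := pow_le_pow_left₀ hR0 hR 2
    _ ≤ ((n : ℝ) + 1) * (arches (2 * n + 1)).card := card_rectangleFuns_sq_le n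

/-! ### `β(a) ≥ μ` for `a ≥ 1`, and `e^{κ(a)} = β(a)` -/

/-- `B_n(a)` is non-decreasing in `a ≥ 0`. [cite: MadrasSlade1993, §1.2 (p. 11)] -/
theorem Bw_mono_fugacity (n : ℕ) {a b : ℝ} (ha : 0 ≤ a) (hab : a ≤ b) : AdsIrr.Bw n a ≤ AdsIrr.Bw n b :=
  Finset.sum_le_sum fun _ _ => pow_le_pow_left₀ ha hab _

/-- **`B_{2n+2}(1) ≥ e^{-(50√(n+1) + 2 log μ)} μ^{2n+2}`**: the arch lower bound, the arch-to-bridge fold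
(`Zd.mul_archZ_le_exp`), and `n + 1 ≤ e^{2√(n+1)}`, `√(2n+1) ≤ 2√(n+1)`. [cite: MadrasSlade1993, Corollary 3.1.6, eq. (3.1.10) (p. 61)] -/
theorem exp_mul_pow_le_Bw_one (n : ℕ) :
    Real.exp (-(50 * Real.sqrt ((n : ℝ) + 1) + 2 * Real.log (connectiveConstant 2))) * connectiveConstant 2 ^ (2 * n + 2) ≤
      AdsIrr.Bw (2 * n + 2) 1 := by
  set μ := connectiveConstant 2 with hμdef
  have hμ : 0 < μ := connectiveConstant_pos 2
  have hn1 : (0 : ℝ) < (n : ℝ) + 1 := by positivity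
  -- the arch count
  have hA : Real.exp (-(36 * Real.sqrt n)) * μ ^ (2 * n) ≤ ((n : ℝ) + 1) * archZ (2 * n + 1) 1 := by
    rw [archZ_one]; exact exp_mul_pow_le_card_arches n
  -- the fold: `A_{2n+1}(1) ≤ e^{6√(2n+1)} B_{2n+2}(1)`
  have hB : archZ (2 * n + 1) 1 ≤ Real.exp (6 * Real.sqrt ((2 * n + 1 : ℕ) : ℝ)) * AdsIrr.Bw (2 * n + 2) 1 := by
    have := mul_archZ_le_exp (2 * n + 1) zero_le_one
    rw [one_mul] at this
    exact this
  -- elementary estimates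
  have hs1 : Real.sqrt (n : ℝ) ≤ Real.sqrt ((n : ℝ) + 1) := Real.sqrt_le_sqrt (by linarith)
  have hs2 : Real.sqrt ((2 * n + 1 : ℕ) : ℝ) ≤ 2 * Real.sqrt ((n : ℝ) + 1) := by
    rw [show (2 : ℝ) * Real.sqrt ((n : ℝ) + 1) = Real.sqrt (4 * ((n : ℝ) + 1)) by
      rw [Real.sqrt_mul' _ hn1.le, show Real.sqrt (4 : ℝ) = 2 by
        rw [show (4 : ℝ) = 2 ^ 2 by norm_num, Real.sqrt_sq (by norm_num)]]]
    exact Real.sqrt_le_sqrt (by push_cast; linarith)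
  have hlog : Real.log ((n : ℝ) + 1) ≤ 2 * Real.sqrt ((n : ℝ) + 1) := by
    have h := Real.log_le_sub_one_of_pos (Real.sqrt_pos.2 hn1)
    rw [Real.log_sqrt hn1.le] at h
    linarith
  have hn_exp : (n : ℝ) + 1 ≤ Real.exp (2 * Real.sqrt ((n : ℝ) + 1)) := by
    calc (n : ℝ) + 1 = Real.exp (Real.log ((n : ℝ) + 1)) := (Real.exp_log hn1).symm
      _ ≤ Real.exp (2 * Real.sqrt ((n : ℝ) + 1)) := Real.exp_le_exp.2 hlog
  have hμ2 : μ ^ (2 * n + 2) = Real.exp (2 * Real.log μ) * μ ^ (2 * n) := by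
    rw [two_mul (Real.log μ), Real.exp_add, Real.exp_log hμ, pow_add, sq]; ring
  -- combine: `e^{-T} μ^{2n+2} (n+1) ≤ (n+1) A e^{...}`-type chain
  have hchain : Real.exp (-(36 * Real.sqrt n)) * μ ^ (2 * n) ≤
      ((n : ℝ) + 1) * (Real.exp (6 * Real.sqrt ((2 * n + 1 : ℕ) : ℝ)) * AdsIrr.Bw (2 * n + 2) 1) :=
    hA.trans (mul_le_mul_of_nonneg_left hB hn1.le)
  have hBw0 : 0 ≤ AdsIrr.Bw (2 * n + 2) 1 := AdsIrr.Bw_nonneg _ zero_le_one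
  -- bound the prefactor `(n+1) e^{6√(2n+1)}` by `e^{14√(n+1)}` and `e^{-36√n} ≥ e^{-36√(n+1)}`
  have hpre : ((n : ℝ) + 1) * Real.exp (6 * Real.sqrt ((2 * n + 1 : ℕ) : ℝ)) ≤ Real.exp (14 * Real.sqrt ((n : ℝ) + 1)) := by
    calc ((n : ℝ) + 1) * Real.exp (6 * Real.sqrt ((2 * n + 1 : ℕ) : ℝ))
        ≤ Real.exp (2 * Real.sqrt ((n : ℝ) + 1)) * Real.exp (12 * Real.sqrt ((n : ℝ) + 1)) :=
          mul_le_mul hn_exp (Real.exp_le_exp.2 (by linarith)) (Real.exp_nonneg _) (Real.exp_nonneg _)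
      _ = Real.exp (14 * Real.sqrt ((n : ℝ) + 1)) := by rw [← Real.exp_add]; ring_nf
  have hkey : Real.exp (-(36 * Real.sqrt ((n : ℝ) + 1))) * μ ^ (2 * n) ≤
      Real.exp (14 * Real.sqrt ((n : ℝ) + 1)) * AdsIrr.Bw (2 * n + 2) 1 := by
    calc Real.exp (-(36 * Real.sqrt ((n : ℝ) + 1))) * μ ^ (2 * n)
        ≤ Real.exp (-(36 * Real.sqrt n)) * μ ^ (2 * n) :=
          mul_le_mul_of_nonneg_right (Real.exp_le_exp.2 (by linarith)) (pow_nonneg hμ.le _)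
      _ ≤ ((n : ℝ) + 1) * Real.exp (6 * Real.sqrt ((2 * n + 1 : ℕ) : ℝ)) * AdsIrr.Bw (2 * n + 2) 1 := by
          rw [mul_assoc]; exact hchain
      _ ≤ Real.exp (14 * Real.sqrt ((n : ℝ) + 1)) * AdsIrr.Bw (2 * n + 2) 1 :=
          mul_le_mul_of_nonneg_right hpre hBw0
  -- divide by `e^{14√(n+1)}`
  have hE : Real.exp (-(50 * Real.sqrt ((n : ℝ) + 1) + 2 * Real.log μ)) * μ ^ (2 * n + 2) =
      Real.exp (-(14 * Real.sqrt ((n : ℝ) + 1))) * (Real.exp (-(36 * Real.sqrt ((n : ℝ) + 1))) * μ ^ (2 * n)) := by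
    rw [hμ2, ← mul_assoc, ← mul_assoc, ← Real.exp_add, ← Real.exp_add]; ring_nf
  rw [hE]
  calc Real.exp (-(14 * Real.sqrt ((n : ℝ) + 1))) * (Real.exp (-(36 * Real.sqrt ((n : ℝ) + 1))) * μ ^ (2 * n))
      ≤ Real.exp (-(14 * Real.sqrt ((n : ℝ) + 1))) * (Real.exp (14 * Real.sqrt ((n : ℝ) + 1)) * AdsIrr.Bw (2 * n + 2) 1) :=
        mul_le_mul_of_nonneg_left hkey (Real.exp_nonneg _)
    _ = AdsIrr.Bw (2 * n + 2) 1 := by rw [← mul_assoc, ← Real.exp_add]; simp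

/-- `(xⁿ)^{1/n} = x` for `n ≥ 1`. [folklore] -/
private theorem pow_rpow_one_div₃ {x : ℝ} (hx : 0 ≤ x) {n : ℕ} (hn : n ≠ 0) :
    (x ^ n) ^ (1 / (n : ℝ)) = x := by
  rw [one_div, Real.pow_rpow_inv_natCast hx hn]

/-- **`μ ≤ β(1)`**: the wall-returning `x`-bridges at fugacity `1` already grow like `μ`.
[cite: MadrasSlade1993, Corollary 3.1.6, eq. (3.1.10) (p. 61)] -/
theorem connectiveConstant_le_of_tendsto_Bw_one {β₁ : ℝ}
    (h : Tendsto (fun n : ℕ => (AdsIrr.Bw n 1) ^ (1 / (n : ℝ))) atTop (𝓝 β₁)) : connectiveConstant 2 ≤ β₁ := by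
  set μ := connectiveConstant 2 with hμdef
  have hμ : 0 < μ := connectiveConstant_pos 2
  set t : ℕ → ℝ := fun n => 50 * Real.sqrt ((n : ℝ) + 1) + 2 * Real.log μ with ht
  -- along `m = 2n+2`
  have hsub : Tendsto (fun n : ℕ => (AdsIrr.Bw (2 * n + 2) 1) ^ (1 / ((2 * n + 2 : ℕ) : ℝ))) atTop (𝓝 β₁) :=
    h.comp (tendsto_atTop_atTop.2 fun b => ⟨b, fun n hn => by omega⟩)
  -- the lower sequence `e^{-t_n/(2n+2)} μ → μ`
  have htn : Tendsto (fun n : ℕ => t n / ((2 * n + 2 : ℕ) : ℝ)) atTop (𝓝 0) := by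
    have hsq : Tendsto (fun n : ℕ => Real.sqrt ((n : ℝ) + 1)) atTop atTop := by
      have h1 := (tendsto_rpow_atTop (by norm_num : (0 : ℝ) < 1 / 2)).comp
        (tendsto_natCast_atTop_atTop.comp (tendsto_add_atTop_nat 1))
      refine h1.congr' (Eventually.of_forall fun n => ?_)
      simp [Function.comp, Real.sqrt_eq_rpow]
    -- `t_n / (2n+2) = 25/√(n+1) + log μ/(n+1)`
    have h1 : Tendsto (fun n : ℕ => 25 / Real.sqrt ((n : ℝ) + 1)) atTop (𝓝 0) := tendsto_const_nhds.div_atTop hsq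
    have h2 : Tendsto (fun n : ℕ => Real.log μ / ((n : ℝ) + 1)) atTop (𝓝 0) :=
      tendsto_const_nhds.div_atTop (tendsto_natCast_atTop_atTop.atTop_add tendsto_const_nhds)
    have h12 := h1.add h2
    rw [add_zero] at h12
    refine h12.congr' (Eventually.of_forall fun n => ?_)
    have hn1 : (0 : ℝ) < (n : ℝ) + 1 := by positivity
    have hs : 0 < Real.sqrt ((n : ℝ) + 1) := Real.sqrt_pos.2 hn1
    have hsq' : Real.sqrt ((n : ℝ) + 1) * Real.sqrt ((n : ℝ) + 1) = (n : ℝ) + 1 := Real.mul_self_sqrt hn1.le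
    simp only [ht]
    push_cast
    field_simp
    nlinarith [hsq']
  have hlow : Tendsto (fun n : ℕ => Real.exp (-(t n / ((2 * n + 2 : ℕ) : ℝ))) * μ) atTop (𝓝 μ) := by
    have hneg : Tendsto (fun n : ℕ => -(t n / ((2 * n + 2 : ℕ) : ℝ))) atTop (𝓝 0) := by
      simpa using htn.neg
    have h1 := ((Real.continuous_exp.tendsto 0).comp hneg).mul_const μ
    simpa using h1
  refine le_of_tendsto_of_tendsto' hlow hsub fun n => ?_
  have hm : (2 * n + 2 : ℕ) ≠ 0 := by omega
  calc Real.exp (-(t n / ((2 * n + 2 : ℕ) : ℝ))) * μ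
      = (Real.exp (-(t n)) * μ ^ (2 * n + 2)) ^ (1 / ((2 * n + 2 : ℕ) : ℝ)) := by
        rw [Real.mul_rpow (Real.exp_nonneg _) (pow_nonneg hμ.le _), pow_rpow_one_div₃ hμ.le hm, ← Real.exp_mul]
        congr 2; ring
    _ ≤ (AdsIrr.Bw (2 * n + 2) 1) ^ (1 / ((2 * n + 2 : ℕ) : ℝ)) :=
        Real.rpow_le_rpow (by positivity) (exp_mul_pow_le_Bw_one n) (by positivity)

/-- **`μ ≤ β(a)` for every `a ≥ 1`**: `B_n(1) ≤ B_n(a)` and `μ ≤ β(1)` («`κ(a) = log μ_d` for `a ≤ 1`» at `a = 1` for the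
unfolded loops). [cite: JansevanRensburgWhittington2013, Lemma 1 (arXiv p. 3: «lim n⁻¹ log L‡_n(a) = κ(a)» and «κ(a) = log μ_d for a ≤ 1»; proof attributed to HammersleyTorrieWhittington1982)]
[cite: MadrasSlade1993, Corollary 3.1.6, eq. (3.1.10) (p. 61)] -/
theorem connectiveConstant_le_bridgeRate {a β : ℝ} (ha : 1 ≤ a)
    (hβlim : Tendsto (fun n : ℕ => (AdsIrr.Bw n a) ^ (1 / (n : ℝ))) atTop (𝓝 β)) : connectiveConstant 2 ≤ β := by
  obtain ⟨β₁, -, hβ₁lim, -⟩ := AdsIrr.exists_tendsto_Bw_rpow one_pos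
  refine (connectiveConstant_le_of_tendsto_Bw_one hβ₁lim).trans (le_of_tendsto_of_tendsto' hβ₁lim hβlim fun n => ?_)
  exact Real.rpow_le_rpow (AdsIrr.Bw_nonneg n zero_le_one) (Bw_mono_fugacity n zero_le_one ha) (by positivity)

/-- **`e^{κ(a)} = β(a)` for `a ≥ 1`**: the adsorption free energy equals the growth rate of the wall-returning `x`-bridges
(= loops unfolded in the `x`-direction) — as printed: «`lim n⁻¹ log L‡_n(a) = κ(a)`».
[cite: JansevanRensburgWhittington2013, Lemma 1 (arXiv p. 3: «lim n⁻¹ log L‡_n(a) = κ(a)», unfolded loops; proof attributed to HammersleyTorrieWhittington1982)]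
[cite: HammersleyTorrieWhittington1982, existence of the free energy κ; reported in BeatonGuttmannJensen2012Adsorption §1 p. 1 (arXiv:1110.6695v1)] -/
theorem adsRate_eq_bridgeRate {a β : ℝ} (ha : 1 ≤ a) (hβ0 : 0 < β)
    (hβlim : Tendsto (fun n : ℕ => (AdsIrr.Bw n a) ^ (1 / (n : ℝ))) atTop (𝓝 β))
    (hβ : ∀ m, AdsIrr.Bw m a ≤ β ^ m) : adsRate a = β := by
  rw [adsRate_eq_max ha hβ0 hβlim hβ, max_eq_left (connectiveConstant_le_bridgeRate ha hβlim)]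

/-- **`Z⁺_n(a)^{1/n} → β(a)` for `a ≥ 1`** («`lim n⁻¹ log C_n(a) = lim n⁻¹ log L‡_n(a)`»).
[cite: JansevanRensburgWhittington2013, Lemma 1 (arXiv p. 3); proof attributed to HammersleyTorrieWhittington1982] -/
theorem tendsto_adsZ_rpow_bridgeRate {a β : ℝ} (ha : 1 ≤ a) (hβ0 : 0 < β)
    (hβlim : Tendsto (fun n : ℕ => (AdsIrr.Bw n a) ^ (1 / (n : ℝ))) atTop (𝓝 β))
    (hβ : ∀ m, AdsIrr.Bw m a ≤ β ^ m) :
    Tendsto (fun n : ℕ => (adsZ n a) ^ (1 / (n : ℝ))) atTop (𝓝 β) := by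
  have h := tendsto_adsZ_rpow_of_one_le ha hβ0 hβlim hβ
  rwa [max_eq_left (connectiveConstant_le_bridgeRate ha hβlim)] at h

end Literature.Probability.RandomPlanarGeometry.SAW.Zd
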